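import Mathlib
import Summits.MatrixMultiplication.MatrixMultiplication.Theses.BrentRefutationDepth
import Summits.MatrixMultiplication.MatrixMultiplication.Theorems.BrentRefutationDepthNSDepthLowerBound
import Literature.Computability.AlgebraicComplexity.BrentEquations

/-!
# Birth skeleton of piece 2 `CertificateProductLaw` (split of stmt-MatrixMultiplication-5580)

ONE open stub and a PROVED rung; composition `CertificateProductLaw_of`:
* `lawBelowFlattening` — PROVED (§P, `productLaw_belowFlattening`, `A = 6`; verbatim from the crux workfile
  `Cruxes/PolyDepthRefutation/EquationToCertificate.lean`): the product law whenever the product bound `⌊c·r·s⌋` is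
  below the flattening rank `(nm)²` of `⟨nm,nm,nm⟩` — the `(q+1)`-minor of the flattening is a degree-`(q+1)` equation,
  equations are shallow certificates (degree `3(q+1)`), and the landed sharp floor `r ≤ D`, `s ≤ D'` does the degree
  bookkeeping `3(⌊c r s⌋+1) ≤ 6·D·D'`; for every `c ≤ 1`.
* `stub_lawAboveFlattening` (the content): the law in the regime `(nm)² ≤ ⌊c·r·s⌋`, where no construction is known.
Composition: `c := min c₂ 1`, `A := max 6 A₂`, case split on the regime, anti-monotonicity in `r`
(`split_hasBrentRefutation_anti`, reproduced verbatim from `Cruxes/PolyDepthRefutation/Split.lean` so that this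
file is self-contained).
-/

set_option linter.dupNamespace false

noncomputable section

namespace Summit.MatrixMultiplication.MatrixMultiplication.Cruxes.PolyDepthRefutation.ProductLawBirth

open scoped BigOperators
open MvPolynomial Finset
open Literature.Computability.AlgebraicComplexity
open Literature.Computability.Complexity (HasNSRefutationWithMultipliersOfDegree)
open Summit.MatrixMultiplication.MatrixMultiplication.Theorems (NSDepth.le_of_brent_refutation)

/-! # §P. Equations are shallow certificates; flattening minors; the law below the flattening rank
(verbatim from `Cruxes/PolyDepthRefutation/EquationToCertificate.lean`) -/


/-! ## Telescoping a difference of monomials with degree control -/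

/-- Degree of a two-variable geometric sum `Σ_{i<m} x^i y^{m-1-i}` when `deg x ≤ κ`, `deg y = 0`. [folklore] -/
theorem split_totalDegree_geom_sum₂_le {σ : Type*} (x y : MvPolynomial σ ℂ) (κ m : ℕ)
    (hx : x.totalDegree ≤ κ) (hy : y.totalDegree = 0) :
    (∑ i ∈ range m, x ^ i * y ^ (m - 1 - i)).totalDegree ≤ κ * m - κ := by
  refine (totalDegree_finsetSum _ _).trans (Finset.sup_le fun i hi => ?_)
  rw [Finset.mem_range] at hi
  calc (x ^ i * y ^ (m - 1 - i)).totalDegree ≤ (x ^ i).totalDegree + (y ^ (m - 1 - i)).totalDegree :=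
        totalDegree_mul _ _
    _ ≤ i * κ + (m - 1 - i) * 0 := by
        refine Nat.add_le_add ((totalDegree_pow _ _).trans (Nat.mul_le_mul_left _ hx)) ?_
        exact (totalDegree_pow _ _).trans (by rw [hy])
    _ = κ * i := by ring
    _ ≤ κ * m - κ := by
        have : i + 1 ≤ m := hi
        have h2 : κ * i + κ ≤ κ * m := by
          have h := Nat.mul_le_mul_left κ this
          rwa [Nat.mul_succ] at h
        omega

/-- **Telescoping.**  For families `a, b` with `deg a_e ≤ κ` and `b_e` constant, and exponents `m`, on any finset `s`:
`Π_{e∈s} a_e^{m_e} − Π_{e∈s} b_e^{m_e} = Σ_{e∈s} (a_e − b_e)·q_e` with `deg q_e ≤ κ·(Σ_{e∈s} m_e) − κ`. [folklore] -/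
theorem split_telescope_prod {σ E : Type*} [DecidableEq E] (a b : E → MvPolynomial σ ℂ) (m : E → ℕ) (κ : ℕ)
    (ha : ∀ e, (a e).totalDegree ≤ κ) (hb : ∀ e, (b e).totalDegree = 0) (s : Finset E) :
    ∃ q : E → MvPolynomial σ ℂ,
      (∏ e ∈ s, a e ^ m e) - (∏ e ∈ s, b e ^ m e) = ∑ e ∈ s, (a e - b e) * q e ∧
      ∀ e, (q e).totalDegree ≤ κ * (∑ e ∈ s, m e) - κ := by
  classical
  induction s using Finset.induction_on with
  | empty => exact ⟨fun _ => 0, by simp, fun e => by simp⟩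
  | @insert e₀ s he₀ ih =>
    obtain ⟨q, hq, hqdeg⟩ := ih
    -- the geometric-sum factor of `a₀^{m₀} − b₀^{m₀}` and the tail product
    set G : MvPolynomial σ ℂ := ∑ i ∈ range (m e₀), a e₀ ^ i * b e₀ ^ (m e₀ - 1 - i) with hG
    set A : MvPolynomial σ ℂ := ∏ e ∈ s, a e ^ m e with hA
    have hgeom : G * (a e₀ - b e₀) = a e₀ ^ m e₀ - b e₀ ^ m e₀ := geom_sum₂_mul _ _ _
    have hAdeg : A.totalDegree ≤ κ * ∑ e ∈ s, m e := by
      refine (totalDegree_finsetProd _ _).trans ?_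
      rw [Finset.mul_sum]
      exact Finset.sum_le_sum fun e _ => (totalDegree_pow _ _).trans
        (by rw [mul_comm κ]; exact Nat.mul_le_mul_left _ (ha e))
    have hGdeg : G.totalDegree ≤ κ * m e₀ - κ := split_totalDegree_geom_sum₂_le _ _ κ (m e₀) (ha e₀) (hb e₀)
    refine ⟨Function.update (fun e => b e₀ ^ m e₀ * q e) e₀ (G * A), ?_, ?_⟩
    · rw [Finset.prod_insert he₀, Finset.prod_insert he₀, Finset.sum_insert he₀, Function.update_self]
      have hrest : ∑ e ∈ s, (a e - b e) * Function.update (fun e => b e₀ ^ m e₀ * q e) e₀ (G * A) e =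
          b e₀ ^ m e₀ * ∑ e ∈ s, (a e - b e) * q e := by
        rw [Finset.mul_sum]
        refine Finset.sum_congr rfl fun e he => ?_
        have hne : e ≠ e₀ := fun h => he₀ (h ▸ he)
        rw [Function.update_of_ne hne]
        ring
      rw [hrest, ← hq, ← hA]
      have : a e₀ ^ m e₀ * A - b e₀ ^ m e₀ * ∏ e ∈ s, b e ^ m e =
          (a e₀ ^ m e₀ - b e₀ ^ m e₀) * A + b e₀ ^ m e₀ * (A - ∏ e ∈ s, b e ^ m e) := by ring
      rw [this, ← hgeom]
      ring
    · intro e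
      rw [Finset.sum_insert he₀]
      by_cases hee : e = e₀
      · subst hee
        rw [Function.update_self]
        by_cases hm0 : m e = 0
        · -- `G = 0`
          have hG0 : G = 0 := by rw [hG, hm0]; simp
          rw [hG0, zero_mul, totalDegree_zero]
          exact Nat.zero_le _
        · calc (G * A).totalDegree ≤ G.totalDegree + A.totalDegree := totalDegree_mul _ _
            _ ≤ (κ * m e - κ) + κ * ∑ e ∈ s, m e := Nat.add_le_add hGdeg hAdeg
            _ = κ * (m e + ∑ e ∈ s, m e) - κ := by
                have : κ ≤ κ * m e := Nat.le_mul_of_pos_right κ (Nat.pos_of_ne_zero hm0)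
                rw [Nat.mul_add]
                omega
      · rw [Function.update_of_ne hee]
        calc (b e₀ ^ m e₀ * q e).totalDegree ≤ (b e₀ ^ m e₀).totalDegree + (q e).totalDegree :=
              totalDegree_mul _ _
          _ ≤ 0 + (κ * (∑ e ∈ s, m e) - κ) := by
              refine Nat.add_le_add ?_ (hqdeg e)
              exact (totalDegree_pow _ _).trans (by rw [hb e₀]; simp)
          _ ≤ κ * (m e₀ + ∑ e ∈ s, m e) - κ := by
              rw [zero_add, Nat.mul_add]
              omega

/-- **Substitution minus evaluation is in the ideal of the axioms, with degree control.**  For `P` of total degree `≤ d`,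
a substitution `F` by polynomials of degree `≤ κ` and a point `c`:
`aeval F P − C (eval c P) = Σ_e (F e − C (c e))·Q_e` with `deg Q_e ≤ κ·d − κ`. [folklore] -/
theorem split_aeval_sub_C_eval {σ E : Type*} [Fintype E] [DecidableEq E]
    (F : E → MvPolynomial σ ℂ) (c : E → ℂ) (κ d : ℕ) (hF : ∀ e, (F e).totalDegree ≤ κ)
    (P : MvPolynomial E ℂ) (hP : P.totalDegree ≤ d) :
    ∃ Q : E → MvPolynomial σ ℂ,
      aeval F P - C (eval c P) = ∑ e, (F e - C (c e)) * Q e ∧ ∀ e, (Q e).totalDegree ≤ κ * d - κ := by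
  classical
  -- telescope each monomial of `P`
  have hmono : ∀ m : E →₀ ℕ, ∃ q : E → MvPolynomial σ ℂ,
      (∏ e, F e ^ m e) - (∏ e, (C (c e) : MvPolynomial σ ℂ) ^ m e) = ∑ e, (F e - C (c e)) * q e ∧
      ∀ e, (q e).totalDegree ≤ κ * (∑ e, m e) - κ :=
    fun m => split_telescope_prod F (fun e => C (c e)) m κ hF (fun e => totalDegree_C _) univ
  choose q hq hqdeg using hmono
  refine ⟨fun e => ∑ m ∈ P.support, C (coeff m P) * q m e, ?_, ?_⟩
  · -- expand `P` as a sum of monomials on both sides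
    have hexp : aeval F P - C (eval c P) =
        ∑ m ∈ P.support, C (coeff m P) * ((∏ e, F e ^ m e) - ∏ e, (C (c e) : MvPolynomial σ ℂ) ^ m e) := by
      conv_lhs => rw [P.as_sum]
      rw [map_sum, map_sum, map_sum, ← Finset.sum_sub_distrib]
      refine Finset.sum_congr rfl fun m _ => ?_
      rw [aeval_monomial, eval_monomial, Finsupp.prod_fintype _ _ (fun e => by simp),
        Finsupp.prod_fintype _ _ (fun e => by simp), map_mul, map_prod]
      simp only [map_pow, algebraMap_eq]
      ring
    rw [hexp]
    simp_rw [hq, Finset.mul_sum]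
    rw [Finset.sum_comm]
    refine Finset.sum_congr rfl fun e _ => ?_
    refine Finset.sum_congr rfl fun m _ => ?_
    ring
  · intro e
    refine (totalDegree_finsetSum _ _).trans (Finset.sup_le fun m hm => ?_)
    calc (C (coeff m P) * q m e).totalDegree ≤ (C (coeff m P) : MvPolynomial σ ℂ).totalDegree + (q m e).totalDegree :=
          totalDegree_mul _ _
      _ ≤ 0 + (κ * (∑ e, m e) - κ) := Nat.add_le_add (totalDegree_C _).le (hqdeg m e)
      _ ≤ κ * d - κ := by
          rw [zero_add]
          have hmd : ∑ e, m e ≤ d := by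
            have h1 : (m.sum fun _ k => k) ≤ P.totalDegree := le_totalDegree hm
            rw [Finsupp.sum_fintype _ _ (fun _ => rfl)] at h1
            exact h1.trans hP
          have := Nat.mul_le_mul_left κ hmd
          omega

/-! ## The theorem -/

/-- **Equations are shallow certificates** (`stub_equationToCertificate`, proved): a degree-`d` polynomial on the tensor
space vanishing on every sum of `r` triads and non-zero at `⟨n,n,n⟩` yields `HasBrentRefutation ℂ n r (3d)`. [folklore] -/
theorem hasBrentRefutation_of_equation (n r d : ℕ)
    (P : MvPolynomial ((Fin n × Fin n) × (Fin n × Fin n) × (Fin n × Fin n)) ℂ)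
    (hdeg : P.totalDegree ≤ d)
    (hvan : ∀ w u v : Fin r → (Fin n × Fin n) → ℂ,
      MvPolynomial.eval (fun e => (∑ t, triad (w t) (u t) (v t)) e.1 e.2.1 e.2.2) P = 0)
    (hne : MvPolynomial.eval (fun e => matMulTensor ℂ n n n e.1 e.2.1 e.2.2) P ≠ 0) :
    HasBrentRefutation ℂ n r (3 * d) := by
  classical
  -- the cubic parametrisation `F_e = Σ_t a_{t,i} b_{t,j} c_{t,k}` and the constants `T_e`
  set F : (Fin n × Fin n) × (Fin n × Fin n) × (Fin n × Fin n) →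
      MvPolynomial (Fin 3 × Fin r × (Fin n × Fin n)) ℂ :=
    fun e => ∑ t : Fin r, X ((0 : Fin 3), t, e.1) * X ((1 : Fin 3), t, e.2.1) * X ((2 : Fin 3), t, e.2.2) with hFdef
  set cT : (Fin n × Fin n) × (Fin n × Fin n) × (Fin n × Fin n) → ℂ :=
    fun e => matMulTensor ℂ n n n e.1 e.2.1 e.2.2 with hcTdef
  have hF3 : ∀ e, (F e).totalDegree ≤ 3 := by
    intro e
    refine (totalDegree_finsetSum _ _).trans (Finset.sup_le fun t _ => ?_)
    calc (X ((0 : Fin 3), t, e.1) * X ((1 : Fin 3), t, e.2.1) * X ((2 : Fin 3), t, e.2.2) :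
            MvPolynomial (Fin 3 × Fin r × (Fin n × Fin n)) ℂ).totalDegree
          ≤ (X ((0 : Fin 3), t, e.1) * X ((1 : Fin 3), t, e.2.1) :
              MvPolynomial (Fin 3 × Fin r × (Fin n × Fin n)) ℂ).totalDegree +
            (X ((2 : Fin 3), t, e.2.2) : MvPolynomial (Fin 3 × Fin r × (Fin n × Fin n)) ℂ).totalDegree :=
          totalDegree_mul _ _
      _ ≤ (1 + 1) + 1 := by
          refine Nat.add_le_add ((totalDegree_mul _ _).trans (Nat.add_le_add ?_ ?_)) ?_ <;>
            exact (totalDegree_X _).le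
      _ = 3 := rfl
  -- `P(F) = 0` identically: it vanishes at every point of `ℂ^{3rn²}`
  have hPF : aeval F P = 0 := by
    haveI : Infinite ℂ := Infinite.of_injective _ Nat.cast_injective
    apply MvPolynomial.funext
    intro x
    rw [map_zero]
    have hcomp : (eval x) (aeval F P) = eval (fun e => eval x (F e)) P := by
      rw [aeval_eq_bind₁]
      simp only [MvPolynomial.eval, eval₂Hom_bind₁]
    rw [hcomp]
    have hpt : (fun e => eval x (F e)) = fun e : (Fin n × Fin n) × (Fin n × Fin n) × (Fin n × Fin n) =>
        (∑ t : Fin r, triad (fun i => x (0, t, i)) (fun j => x (1, t, j)) (fun k => x (2, t, k))) e.1 e.2.1 e.2.2 := by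
      funext e
      simp [hFdef, Finset.sum_apply, triad]
    rw [hpt]
    exact hvan _ _ _
  -- telescoping with degree control
  obtain ⟨Q, hQ, hQdeg⟩ := split_aeval_sub_C_eval F cT 3 d hF3 P hdeg
  rw [hPF, zero_sub] at hQ
  -- the refutation: multipliers `−P(T)⁻¹ · Q_e`
  set θ : ℂ := eval cT P with hθ
  have hθne : θ ≠ 0 := hne
  refine ⟨univ, fun e => C (-θ⁻¹) * Q e, ?_, fun e _ => ?_⟩
  · -- `Σ_e (−θ⁻¹ Q_e)·(F_e − T_e) = −θ⁻¹ · (−θ) = 1`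
    have hB : ∀ e : (Fin n × Fin n) × (Fin n × Fin n) × (Fin n × Fin n),
        brentSystem ℂ n r e.1 e.2.1 e.2.2 = F e - C (cT e) := fun e => rfl
    calc ∑ e ∈ univ, C (-θ⁻¹) * Q e * brentSystem ℂ n r e.1 e.2.1 e.2.2
        = C (-θ⁻¹) * ∑ e, (F e - C (cT e)) * Q e := by
          rw [Finset.mul_sum]
          refine Finset.sum_congr rfl fun e _ => ?_
          rw [hB]; ring
      _ = C (-θ⁻¹) * (-C θ) := by rw [← hQ]
      _ = 1 := by
          rw [← map_neg, ← map_mul, show -θ⁻¹ * -θ = 1 by field_simp, map_one]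
  · calc (C (-θ⁻¹) * Q e).totalDegree ≤ (C (-θ⁻¹) : MvPolynomial _ ℂ).totalDegree + (Q e).totalDegree :=
          totalDegree_mul _ _
      _ ≤ 0 + (3 * d - 3) := Nat.add_le_add (totalDegree_C _).le (hQdeg e)
      _ ≤ 3 * d := by omega

/-! ## §2. Flattening-minor certificates and the product law below the flattening rank -/

/-- `B(N, 0)` is refutable with multipliers of degree `0` (`N ≥ 1`): the equation `−⟨N,N,N⟩_{e₀} = −1` at a support
entry `e₀`. [folklore] -/
theorem hasBrentRefutation_zero_right {N : ℕ} (hN : 1 ≤ N) : HasBrentRefutation ℂ N 0 0 := by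
  classical
  set z : Fin N := ⟨0, hN⟩ with hz
  refine ⟨{((z, z), (z, z), (z, z))}, fun _ => C (-1), ?_, fun e _ => by simp⟩
  rw [Finset.sum_singleton]
  have hB : brentSystem ℂ N 0 (z, z) (z, z) (z, z) = -C 1 := by
    simp [brentSystem, matMulTensor]
  simp only
  rw [hB, ← map_neg C (1 : ℂ), ← map_mul]
  norm_num

/-- **Flattening-minor certificates**: for `r + 1 ≤ N²` the Brent system `B(N, r)` has a Nullstellensatz refutation
with multipliers of degree `≤ 3(r+1)` — the `(r+1)×(r+1)` identity minor of the flattening of `⟨N,N,N⟩` is a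
degree-`(r+1)` equation for the sums of `r` triads (`rank ≤ r`) that evaluates to `1` at `⟨N,N,N⟩`; then
`hasBrentRefutation_of_equation`. [folklore] -/
theorem hasBrentRefutation_flattening {N r : ℕ} (hr : r + 1 ≤ N * N) :
    HasBrentRefutation ℂ N r (3 * (r + 1)) := by
  classical
  have hN : 1 ≤ N := by
    rcases Nat.eq_zero_or_pos N with h | h
    · subst h; simp at hr
    · exact h
  set z : Fin N := ⟨0, hN⟩ with hz
  -- `r + 1` distinct row indices
  let ρ : Fin (r + 1) → Fin N × Fin N := fun u => finProdFinEquiv.symm (Fin.castLE hr u)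
  have hρ : Function.Injective ρ :=
    finProdFinEquiv.symm.injective.comp (Fin.castLE_injective hr)
  -- the minor, as a polynomial on the tensor space
  let idx : Fin (r + 1) → Fin (r + 1) → (Fin N × Fin N) × (Fin N × Fin N) × (Fin N × Fin N) :=
    fun u u' => (ρ u, ((ρ u').1, z), (z, (ρ u').2))
  let M : Matrix (Fin (r + 1)) (Fin (r + 1))
      (MvPolynomial ((Fin N × Fin N) × (Fin N × Fin N) × (Fin N × Fin N)) ℂ) :=
    fun u u' => X (idx u u')
  refine hasBrentRefutation_of_equation N r (r + 1) M.det ?_ ?_ ?_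
  · -- degree `≤ r + 1`
    rw [Matrix.det_apply]
    refine (totalDegree_finsetSum _ _).trans (Finset.sup_le fun σ _ => ?_)
    have hprod : (∏ i, M (σ i) i).totalDegree ≤ r + 1 := by
      refine (totalDegree_finsetProd _ _).trans ?_
      calc ∑ i, (M (σ i) i).totalDegree = ∑ i : Fin (r + 1), 1 :=
            Finset.sum_congr rfl fun i _ => totalDegree_X _
        _ ≤ r + 1 := by simp
    rcases Int.units_eq_one_or (Equiv.Perm.sign σ) with h | h
    · rw [h, one_smul]; exact hprod
    · rw [h, Units.neg_smul, one_smul, totalDegree_neg]; exact hprod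
  · -- vanishing on sums of `r` triads: the evaluated minor is `det (A·B)` with inner dimension `r`
    intro w u v
    rw [RingHom.map_det, RingHom.mapMatrix_apply]
    set A : Matrix (Fin (r + 1)) (Fin r) ℂ := fun a t => w t (ρ a) with hA
    set B : Matrix (Fin r) (Fin (r + 1)) ℂ := fun t b => u t ((ρ b).1, z) * v t (z, (ρ b).2) with hB
    have hmap : M.map (MvPolynomial.eval fun e => (∑ t, triad (w t) (u t) (v t)) e.1 e.2.1 e.2.2) = A * B := by
      ext a b
      simp [M, idx, Matrix.map_apply, Matrix.mul_apply, A, B, Finset.sum_apply, triad, mul_assoc]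
    rw [hmap]
    by_contra hdet
    have hU : IsUnit (A * B) := (Matrix.isUnit_iff_isUnit_det _).2 (isUnit_iff_ne_zero.2 hdet)
    have h1 := Matrix.rank_of_isUnit _ hU
    have h2 := Matrix.rank_mul_le_left A B
    have h3 := Matrix.rank_le_width A
    rw [Fintype.card_fin] at h1
    omega
  · -- value `1` at `⟨N,N,N⟩`: the evaluated minor is the identity matrix
    rw [RingHom.map_det, RingHom.mapMatrix_apply]
    have hmap : M.map (MvPolynomial.eval fun e => matMulTensor ℂ N N N e.1 e.2.1 e.2.2) = 1 := by
      ext a b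
      simp only [M, idx, Matrix.map_apply, eval_X, Matrix.one_apply]
      by_cases h : a = b
      · subst h
        simp [matMulTensor]
      · have hne : ρ a ≠ ρ b := fun h' => h (hρ h')
        rw [if_neg h]
        simp only [matMulTensor]
        rw [if_neg]
        rintro ⟨h1, -, h2⟩
        exact hne (Prod.ext h1 h2)
    rw [hmap, Matrix.det_one]
    exact one_ne_zero

/-- **The product law below the flattening rank** (`stub_lawBelowFlattening` of the piece-2 birth skeleton, with
`A = 6`): for every `c ≤ 1`, certificates for `B(n, r)` and `B(m, s)` of degrees `D, D'` give one for
`B(nm, ⌊c·r·s⌋)` of degree `≤ 6·D·D'` whenever `⌊c·r·s⌋ < (nm)²` (flattening minor + the sharp floor `r ≤ D`,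
`s ≤ D'`). [folklore] -/
theorem productLaw_belowFlattening :
    ∀ a : ℕ, ∀ c : ℝ, 0 < c → c ≤ 1 → ∃ A : ℕ, ∀ n m r s D D' : ℕ, D ≤ r ^ a → D' ≤ s ^ a →
      HasBrentRefutation ℂ n r D → HasBrentRefutation ℂ m s D' → ⌊c * r * s⌋₊ < (n * m) ^ 2 →
        HasBrentRefutation ℂ (n * m) ⌊c * r * s⌋₊ (A * D * D') := by
  intro a c hc hc1
  refine ⟨6, fun n m r s D D' _ _ hn hm hlt => ?_⟩
  -- the sharp floor `r ≤ D`, `s ≤ D'`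
  have hrD : r ≤ D := by
    obtain ⟨g, hg, hsum⟩ := (hasBrentRefutation_iff ℂ n r D).1 hn
    exact NSDepth.le_of_brent_refutation n r D g hg hsum
  have hsD : s ≤ D' := by
    obtain ⟨g, hg, hsum⟩ := (hasBrentRefutation_iff ℂ m s D').1 hm
    exact NSDepth.le_of_brent_refutation m s D' g hg hsum
  have hnm : 1 ≤ n * m := by
    rcases Nat.eq_zero_or_pos (n * m) with h | h
    · rw [h] at hlt; simp at hlt
    · exact h
  -- `q := ⌊c r s⌋ ≤ r s ≤ D D'`
  set q : ℕ := ⌊c * r * s⌋₊ with hq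
  have hqrs : q ≤ r * s := by
    have h1 : (q : ℝ) ≤ c * r * s := Nat.floor_le (by positivity)
    have h2 : c * r * s ≤ (r : ℝ) * s := by
      have : (0 : ℝ) ≤ (r : ℝ) * s := by positivity
      nlinarith
    exact_mod_cast h1.trans h2
  have hqDD : q ≤ D * D' := hqrs.trans (Nat.mul_le_mul hrD hsD)
  rcases Nat.eq_zero_or_pos (D * D') with hzero | hpos
  · -- `D = 0` or `D' = 0`: then `q = 0` and `B(nm, 0)` is refutable in degree `0`
    have hq0 : q = 0 := Nat.le_zero.1 (hzero ▸ hqDD)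
    rw [hq0, show 6 * D * D' = 0 by rw [mul_assoc, hzero, mul_zero]]
    exact hasBrentRefutation_zero_right hnm
  · have hcert : HasBrentRefutation ℂ (n * m) q (3 * (q + 1)) :=
      hasBrentRefutation_flattening (by rw [← pow_two]; exact hlt)
    refine hcert.mono ?_
    have : q + 1 ≤ 2 * (D * D') := by omega
    calc 3 * (q + 1) ≤ 3 * (2 * (D * D')) := Nat.mul_le_mul_left 3 this
      _ = 6 * D * D' := by ring


/-! ## Anti-monotonicity in `r` (verbatim from `Split.lean`) -/

/-- A substitution by polynomials of degree `≤ 1` does not increase the total degree. [folklore] -/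
theorem split_totalDegree_bind₁_le {R : Type*} [CommSemiring R] {σ τ : Type*}
    {h : σ → MvPolynomial τ R} (hh : ∀ v, (h v).totalDegree ≤ 1)
    (p : MvPolynomial σ R) : (bind₁ h p).totalDegree ≤ p.totalDegree := by
  classical
  conv_lhs => rw [p.as_sum, map_sum]
  refine (totalDegree_finsetSum _ _).trans (Finset.sup_le fun m hm => ?_)
  rw [bind₁_monomial]
  refine (totalDegree_mul _ _).trans ?_
  rw [totalDegree_C, zero_add]
  change (∏ v ∈ m.support, h v ^ m v).totalDegree ≤ _
  refine (totalDegree_finsetProd _ _).trans ?_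
  calc ∑ v ∈ m.support, (h v ^ m v).totalDegree ≤ ∑ v ∈ m.support, m v := Finset.sum_le_sum fun v _ =>
        (totalDegree_pow _ _).trans (by have := hh v; nlinarith)
    _ = m.sum fun _ e => e := rfl
    _ ≤ p.totalDegree := le_totalDegree hm


/-- If an algebra hom maps each axiom of `𝒜` to the corresponding axiom of `ℬ` and does not increase total
degrees, it maps NS refutations of `𝒜` with multipliers of degree `≤ D` to such refutations of `ℬ`. [folklore] -/
theorem split_transport {K : Type*} [CommRing K] {ι σ τ : Type*}
    {𝒜 : ι → MvPolynomial σ K} {ℬ : ι → MvPolynomial τ K} {D : ℕ}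
    (φ : MvPolynomial σ K →ₐ[K] MvPolynomial τ K)
    (hφ : ∀ a, φ (𝒜 a) = ℬ a) (hdeg : ∀ p : MvPolynomial σ K, (φ p).totalDegree ≤ p.totalDegree)
    (h : HasNSRefutationWithMultipliersOfDegree 𝒜 D) : HasNSRefutationWithMultipliersOfDegree ℬ D := by
  obtain ⟨s, g, hsum, hd⟩ := h
  refine ⟨s, fun a => φ (g a), ?_, fun a ha => (hdeg _).trans (hd a ha)⟩
  have key := congrArg φ hsum
  rw [map_sum, map_one] at key
  simpa [map_mul, hφ] using key


/-- **Fewer triads are easier to refute**: a refutation of `B(n, r)` of multiplier degree `≤ D` yields one of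
`B(n, r')` for every `r' ≤ r` (substitute `0` for the unknowns of the triads `t ≥ r'`: the Brent polynomials of
`B(n, r)` become those of `B(n, r')`, degrees do not increase). [folklore] -/
theorem split_hasBrentRefutation_anti {n r r' D : ℕ} (hr : r' ≤ r)
    (h : HasBrentRefutation ℂ n r D) : HasBrentRefutation ℂ n r' D := by
  classical
  -- the substitution killing the triads `t ≥ r'`
  let f : Fin 3 × Fin r × (Fin n × Fin n) → MvPolynomial (Fin 3 × Fin r' × (Fin n × Fin n)) ℂ :=
    fun v => if hv : (v.2.1 : ℕ) < r' then X (v.1, ⟨v.2.1, hv⟩, v.2.2) else 0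
  have hf1 : ∀ v, (f v).totalDegree ≤ 1 := by
    intro v
    simp only [f]
    split_ifs
    · exact (totalDegree_X _).le
    · simp
  refine split_transport (bind₁ f) (fun e => ?_) (fun p => split_totalDegree_bind₁_le hf1 p) h
  obtain ⟨i, j, k⟩ := e
  simp only [brentSystem, map_sub, map_sum, map_mul, bind₁_X_right, bind₁_C_right]
  congr 1
  -- `∑_{t<r} f(0,t,i) f(1,t,j) f(2,t,k) = ∑_{t'<r'} X(0,t',i) X(1,t',j) X(2,t',k)`
  have hmap : ∑ t ∈ (univ : Finset (Fin r')).map (Fin.castLEEmb hr),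
      f ((0 : Fin 3), t, i) * f ((1 : Fin 3), t, j) * f ((2 : Fin 3), t, k) =
      ∑ t : Fin r', (X ((0 : Fin 3), t, i) * X ((1 : Fin 3), t, j) * X ((2 : Fin 3), t, k) :
        MvPolynomial (Fin 3 × Fin r' × (Fin n × Fin n)) ℂ) := by
    rw [sum_map]
    refine sum_congr rfl fun t _ => ?_
    simp [f, Fin.castLEEmb, t.isLt]
  rw [← hmap]
  symm
  refine sum_subset (subset_univ _) fun t _ ht => ?_
  have htr : ¬ (t : ℕ) < r' := fun hlt => ht (mem_map.2 ⟨⟨t, hlt⟩, mem_univ _, Fin.ext rfl⟩)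
  simp [f, htr]


/-! ## The skeleton of the piece -/


/-- STUB (the content of the piece): the product law at and above the flattening rank of the product format. -/
theorem stub_lawAboveFlattening :
    ∀ a : ℕ, ∃ c : ℝ, 0 < c ∧ ∃ A : ℕ, ∀ n m r s D D' : ℕ, D ≤ r ^ a → D' ≤ s ^ a →
      HasBrentRefutation ℂ n r D → HasBrentRefutation ℂ m s D' → (n * m) ^ 2 ≤ ⌊c * r * s⌋₊ →
        HasBrentRefutation ℂ (n * m) ⌊c * r * s⌋₊ (A * D * D') := by
  sorry

/-- COMPOSITION (the skeleton theorem of the piece: its one hypothesis is the open stub's statement; the rung below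
the flattening rank is the proved `productLaw_belowFlattening`): the piece `CertificateProductLaw`, verbatim. -/
theorem CertificateProductLaw_of
    (hhi : ∀ a : ℕ, ∃ c : ℝ, 0 < c ∧ ∃ A : ℕ, ∀ n m r s D D' : ℕ, D ≤ r ^ a → D' ≤ s ^ a →
      HasBrentRefutation ℂ n r D → HasBrentRefutation ℂ m s D' → (n * m) ^ 2 ≤ ⌊c * r * s⌋₊ →
        HasBrentRefutation ℂ (n * m) ⌊c * r * s⌋₊ (A * D * D')) :
    ∀ a : ℕ, ∃ c : ℝ, 0 < c ∧ ∃ A : ℕ, ∀ n m r s D D' : ℕ, D ≤ r ^ a → D' ≤ s ^ a →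
      HasBrentRefutation ℂ n r D → HasBrentRefutation ℂ m s D' →
        HasBrentRefutation ℂ (n * m) ⌊c * r * s⌋₊ (A * D * D') := by
  intro a
  obtain ⟨c₂, hc₂, A₂, h₂⟩ := hhi a
  set c : ℝ := min c₂ 1 with hcdef
  have hc : 0 < c := lt_min hc₂ one_pos
  have hc1 : c ≤ 1 := min_le_right _ _
  have hcc₂ : c ≤ c₂ := min_le_left _ _
  obtain ⟨A₁, h₁⟩ := productLaw_belowFlattening a c hc hc1
  refine ⟨c, hc, max A₁ A₂, fun n m r s D D' hD hD' hn hm => ?_⟩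
  -- `⌊c r s⌋ ≤ ⌊c₂ r s⌋`
  have hfloor : ⌊c * r * s⌋₊ ≤ ⌊c₂ * r * s⌋₊ := by
    apply Nat.floor_mono
    have : (0 : ℝ) ≤ (r : ℝ) * s := by positivity
    nlinarith
  by_cases hreg : (n * m) ^ 2 ≤ ⌊c₂ * r * s⌋₊
  · -- above the flattening rank at `c₂`: stub 2, then discard triads down to `⌊c r s⌋`
    have h := h₂ n m r s D D' hD hD' hn hm hreg
    exact (split_hasBrentRefutation_anti hfloor h).mono
      (Nat.mul_le_mul_right _ (Nat.mul_le_mul_right _ (le_max_right _ _)))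
  · -- below: stub 1 at `c`
    have hlt : ⌊c * r * s⌋₊ < (n * m) ^ 2 := lt_of_le_of_lt hfloor (not_le.1 hreg)
    exact (h₁ n m r s D D' hD hD' hn hm hlt).mono
      (Nat.mul_le_mul_right _ (Nat.mul_le_mul_right _ (le_max_left _ _)))

/-- The piece from the stub BY NAME (inherits exactly its `sorry`). -/
theorem CertificateProductLaw_closed :
    ∀ a : ℕ, ∃ c : ℝ, 0 < c ∧ ∃ A : ℕ, ∀ n m r s D D' : ℕ, D ≤ r ^ a → D' ≤ s ^ a →
      HasBrentRefutation ℂ n r D → HasBrentRefutation ℂ m s D' →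
        HasBrentRefutation ℂ (n * m) ⌊c * r * s⌋₊ (A * D * D') :=
  CertificateProductLaw_of stub_lawAboveFlattening

end Summit.MatrixMultiplication.MatrixMultiplication.Cruxes.PolyDepthRefutation.ProductLawBirth
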